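import Literature.NumberTheory.Automorphic.IwasawaDecompositionGL
import HarnessLib

/-!
# Characters of `Fˣ` are determined by their values on uniformizers

Topic `NumberTheory/Automorphic` (next to `IwasawaDecompositionGL`, whose `exists_eq_zpow_mul_of_ne_zero`
is the decomposition `x = ϖ^a e`, `|e| = 1`); theorems only (no definition, no named fact).  Let `F` be a
field with a valuation whose valuation ring `𝒪[F]` is a discrete valuation ring (e.g. a non-archimedean
local field) and `IsUniformizingElement ϖ` the tree's uniformizer predicate (`HeckeTransversalGL`).

* `IsUniformizingElement.unit_mul` — if `ϖ` is a uniformizer and `|e| = 1` then `e ϖ` is a uniformizer;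
* `monoidHom_ext_of_isUniformizingElement` — two homomorphisms `φ ψ : Fˣ →* M` into a group that agree
  on every uniformizer are EQUAL: every unit `e` is the quotient `(e ϖ) ϖ⁻¹` of two uniformizers, and
  `Fˣ = ϖ^ℤ · 𝒪ˣ`;
* `exists_isUniformizingElement_map_ne` — contrapositive: `φ ≠ ψ` gives a uniformizer `ϖ` with
  `φ(ϖ) ≠ ψ(ϖ)`.

Use (cell hodgecm-mathlib, row IV-3b, `Zelevinsky1980.parabolicIndGL_detChar_unitary_isIrreducible`, the
case `N = 2`): the closed- and open-orbit exponents of `Ind_B^{GL₂}(ν₀ ⊠ χ′)` at `d(ϖ)` are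
`χ′(ϖ) q^{1/2}` and `ν₀(ϖ) q^{1/2}` (`Zelevinsky1980/InducedMaximalParabolicEndomorphisms`,
`exists_intertwiningMap_eq_smul`, hypothesis `q_F σ'(d₀(ϖ)) ≠ σ'(d(ϖ))`); for `ν₀ ≠ χ′` they differ for a
suitable CHOICE of the uniformizer `ϖ` by `exists_isUniformizingElement_map_ne`, although they may
coincide for a given one.  (Bernstein–Zelevinsky 1977, Thm. 5.2 / §7.1 analyse the Jacquet module as a
module over the whole torus; this lemma replaces the torus by the uniformizers it is generated by.)

## References

* I. N. Bernstein, A. V. Zelevinsky, *Induced representations of reductive `p`-adic groups I*,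
  Ann. Sci. ÉNS 10 (1977), Thm. 5.2, §7.1. [BernsteinZelevinskyASENS1977]
* J.-P. Serre, *Local fields*, GTM 67, Chap. I §1 (`K* = π^ℤ × U_K`). [Serre1979]
-/

namespace Literature.NumberTheory.Automorphic

open ValuativeRel

variable {F : Type*} [Field F] [ValuativeRel F]

/-- **A unit multiple of a uniformizer is a uniformizer**: if `ϖ` generates the maximal ideal of `𝒪[F]`
and `|e| = 1` then so does `e ϖ`. [cite: Serre1979, Chap. I §1] -/
theorem IsUniformizingElement.unit_mul {ϖ e : F} (hϖ : IsUniformizingElement ϖ) (he : valuation F e = 1) :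
    IsUniformizingElement (e * ϖ) := by
  have heO : e ∈ 𝒪[F] := (Valuation.mem_integer_iff _ _).2 he.le
  have heu : IsUnit (⟨e, heO⟩ : 𝒪[F]) :=
    (Valuation.integer.integers (valuation F)).isUnit_iff_valuation_eq_one.2 he
  refine ⟨Subring.mul_mem _ heO hϖ.mem, mul_ne_zero (fun h => by simp [h] at he) hϖ.ne_zero, ?_⟩
  rw [hϖ.span_eq]
  exact (Ideal.span_singleton_mul_left_unit heu ⟨ϖ, hϖ.mem⟩).symm

variable [IsDiscreteValuationRing 𝒪[F]]

/-- **Homomorphisms out of `Fˣ` are determined by their values on uniformizers.** If `𝒪[F]` is a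
discrete valuation ring and `φ ψ : Fˣ →* M` (`M` a group) satisfy `φ(ϖ) = ψ(ϖ)` for EVERY uniformizer
`ϖ`, then `φ = ψ`: for `x = ϖ^a e` with `|e| = 1`, both `ϖ` and `e ϖ` are uniformizers, so
`φ(e) = φ(eϖ) φ(ϖ)⁻¹ = ψ(e)`. [cite: Serre1979, Chap. I §1] -/
theorem monoidHom_ext_of_isUniformizingElement {M : Type*} [Group M] {φ ψ : Fˣ →* M}
    (h : ∀ (ϖ : F) (hϖ : IsUniformizingElement ϖ), φ (Units.mk0 ϖ hϖ.ne_zero) = ψ (Units.mk0 ϖ hϖ.ne_zero)) :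
    φ = ψ := by
  -- a uniformizer exists
  obtain ⟨p, hp⟩ := IsDiscreteValuationRing.exists_irreducible 𝒪[F]
  have hϖ : IsUniformizingElement (p : F) :=
    ⟨p.2, fun h0 => hp.ne_zero (Subtype.ext h0), by
      rw [(IsDiscreteValuationRing.irreducible_iff_uniformizer _).mp hp]⟩
  ext x
  obtain ⟨a, e, he, hx⟩ := exists_eq_zpow_mul_of_ne_zero hϖ x.ne_zero
  have he0 : e ≠ 0 := fun h0 => by simp [h0] at he
  -- `x = ϖ^a · e` in `Fˣ`
  have hxu : x = (Units.mk0 (p : F) hϖ.ne_zero) ^ a * Units.mk0 e he0 := by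
    ext; simp [hx]
  -- `φ(e) = ψ(e)` from the two uniformizers `ϖ` and `e ϖ`
  have heϖ : IsUniformizingElement (e * (p : F)) := hϖ.unit_mul he
  have hmk : Units.mk0 (e * (p : F)) heϖ.ne_zero = Units.mk0 e he0 * Units.mk0 (p : F) hϖ.ne_zero := by
    ext; simp
  have he' : φ (Units.mk0 e he0) = ψ (Units.mk0 e he0) := by
    have h2 := h _ heϖ
    rw [hmk, map_mul, map_mul, h _ hϖ] at h2
    exact mul_right_cancel h2
  rw [hxu, map_mul, map_mul, map_zpow, map_zpow, h _ hϖ, he']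

/-- **Two distinct homomorphisms out of `Fˣ` differ at some uniformizer** (contrapositive of
`monoidHom_ext_of_isUniformizingElement`). For characters `ν₀ ≠ χ′ : Fˣ →* ℂˣ` this provides a
uniformizer `ϖ` with `ν₀(ϖ) ≠ χ′(ϖ)`, i.e. distinct `d(ϖ)`-exponents `ν₀(ϖ) q^{1/2} ≠ χ′(ϖ) q^{1/2}` of
`Ind_B^{GL₂}(ν₀ ⊠ χ′)` (Bernstein–Zelevinsky 1977, §7.1, the two orbits). [cite: BernsteinZelevinskyASENS1977, §7.1] -/
theorem exists_isUniformizingElement_map_ne {M : Type*} [Group M] {φ ψ : Fˣ →* M} (hne : φ ≠ ψ) :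
    ∃ (ϖ : F) (hϖ : IsUniformizingElement ϖ), φ (Units.mk0 ϖ hϖ.ne_zero) ≠ ψ (Units.mk0 ϖ hϖ.ne_zero) := by
  by_contra hcon
  push Not at hcon
  exact hne (monoidHom_ext_of_isUniformizingElement hcon)

end Literature.NumberTheory.Automorphic
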